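import Summits.HodgeConjecture.CorCM.Census.CentralSquaresOrbitCorner
import Summits.HodgeConjecture.CorCM.Census.CentralSquaresMixedFaceCoords
import Summits.HodgeConjecture.CorCM.Census.TwistScrewShift

/-!
# The square-central class, XXXV: the DESIGNATED ORBIT FACE — `R(T) + Y'(A) − Y'_a − Y'_{a'} ∈ L` for a `σ`-neighbour `a'` of `a`

COR-CM (cell `pub-hodgecm2`), count-neutral kernel combinatorics by the binder seat b09 (gen 47; lane SQUARE-CENTRAL CLASS, part XXXV), on part XXXIV
(`single_sub_thetaG_mem_or_of_orbit_corner`: the dichotomy at the orbit corners), part III (`rt_eq_self_of_transversal`), part VI (`thetaG_frame`),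
part XXVII (`thetaG_typeSum_oflipCM_of_not_mem`) and gen 31/35ʼs transport `mapDomain_rt_thetaG`, BY NAME.  Theorems only: no definition, no `decide`,
no certificate, no named fact, no `sorry`.  HONEST FRAMING: `HC_CM` is NOT proved, here or anywhere in the tree; nothing here is a period or a headline.

THE MECHANISM OF THE KERNEL-FOUR ROWS (design note `KERNEL-FOUR.md`, gen 47; numerically robust in all 28 configurations of order 32 with a reflection
lift of order 4).  Base-involutive frame `(T₀; T₁, Q)` (`T₀·Q⁻¹ = T₁`, `T₁·Q⁻¹ = T₀`), `T ⊆ 𝓗` a transversal of the place permutation `σ` of `Q`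
(`|T| = m ≥ 2`), `A ⊆ T₀ ∖ 𝓗` a `σ`-STABLE set with `|A| ≤ m` (in the rows: a `σ`-orbit of size `4 = m`), `Φ = {T ∣ A}` (deviation set `T ∪ A`;
`Q`-stable by part III).  The DESIGNATED FACE is the face of `Φ` at the places of `a₀ ∈ A` and its `σ`-image `a₁ ∈ A`; let `a₃ ∈ A` be the
`σ`-preimage of `a₀`.  Its `Q`-translate is the face of `Φ` at `a₃, a₀`, so `W = F − F·Q⁻¹ = [Φ^{(a₀a₁)}] − [Φ^{(a₁)}] − [Φ^{(a₃a₀)}] + [Φ^{(a₃)}] ∈ L`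
(the type `Φ` cancels).  The corners `Φ^{(a₀)} = {T ∣ A ∖ a₀}` and `Φ^{(a₀a₁)} = {T ∣ A ∖ {a₀, a₁}}` are orbit corners of part XXXIV, resolved by the
strict cover toward `T₀` or `T₁` (directions `j₂`, `j₁`); `Φ^{(a₁)} = Φ^{(a₀)}·Q` and `Φ^{(a₃)} = Φ^{(a₀)}·Q⁻¹`, `Φ^{(a₃a₀)} = Φ^{(a₀a₁)}·Q⁻¹` carry the
OPPOSITE directions (transport, `mapDomain_rt_thetaG`).  Every flipped place is a deviation place of `Φ` relative to both `T₀` and `T₁`, so all star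
forms are star forms of `Φ` minus flip classes (part XXVII), and in each of the four direction cases
`W ≡ ±((θ_{T₀} − θ_{T₁})(typeSum [Φ]) − Y'_{a₀} − Y'_{x})` with `x = a₁` or `x = a₃` (§2 **`orbit_face_relation`**), where
`(θ_{T₀} − θ_{T₁})(typeSum [Φ]) = R(T) + Σ_{a ∈ A} Y'_a` EXACTLY (§1 `thetaG_sub_thetaG_orbit_type`).  For `|A| = 4` this is `R(T)` plus the sum of
`Y'` over the complementary CONSECUTIVE pair of the orbit; the four `⟨Q⟩`-translates of the designated face give all four consecutive sums (part XXXVI).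

## References
* [Pohlmann1968] H. Pohlmann, Algebraic cycles on abelian varieties of complex multiplication type, Ann. of Math. 88 (1968), Thm 1.
-/

namespace Summit.HodgeConjecture.CorCM.Census.CentralSquares

open Finset
open scoped symmDiff
open Summit.HodgeConjecture.CorCM.Prior.AllgGroup.RfwfAllgGroup
open Summit.HodgeConjecture.CorCM.Census.BlockParity
open Summit.HodgeConjecture.CorCM.Census.Coinvariant
open Summit.HodgeConjecture.CorCM.Census.TwistGeneration
open Summit.HodgeConjecture.CorCM.Census.BaseBlock
open Summit.HodgeConjecture.CorCM.Census.CoverClosure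

noncomputable section

variable {G : Type*} [Group G] [Fintype G] [DecidableEq G] (c : G)

section Frame

variable (hc2 : c * c = 1) (hcen : ∀ x : G, x * c = c * x) (T₀ T₁ : CMF G c)
variable (hbase : ∀ Q : G, rt c Q T₀ = T₀ ∨ rt c Q T₀ = rt c c T₀ ∨ rt c Q T₀ = T₁ ∨ rt c Q T₀ = rt c c T₁)
variable (m : ℕ) (hn : T₀.1.card = 4 * m) (hH : (T₀.1 \ T₁.1).card = 2 * m)
variable (Q : G) (hQ : rt c Q T₀ = T₁) (hQ₁ : rt c Q T₁ = T₀)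
variable (hσH : ∀ t ∈ T₀.1, ∀ t' ∈ T₀.1, (t' = t * Q ∨ t' = c * (t * Q)) → (t ∈ T₀.1 \ T₁.1 ↔ t' ∈ T₀.1 \ T₁.1))
variable (L : Submodule ℤ (CMF G c →₀ ℤ)) (hLrt : ∀ (Q' : G) (y : CMF G c →₀ ℤ), y ∈ L → Finsupp.mapDomain (rt c Q') y ∈ L)
variable (hcover : ∀ Ψ : CMF G c, 2 ≤ bpot c T₀ Ψ → ∃ Q₂ s s' : G, bpot c T₀ Ψ = ddist (rt c Q₂ T₀) Ψ ∧
    s ∈ (rt c Q₂ T₀).1 \ Ψ.1 ∧ s' ∈ (rt c Q₂ T₀).1 \ Ψ.1 ∧ s ≠ s' ∧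
    gface c hc2 Ψ s s' ∈ L ∧
    ((∃ Q₁ t t' : G, bpot c T₀ Ψ = ddist (rt c Q₁ T₀) Ψ ∧ t ∈ (rt c Q₁ T₀).1 \ Ψ.1 ∧ t' ∈ (rt c Q₁ T₀).1 \ Ψ.1 ∧ t ≠ t' ∧
        (∀ Q' : G, ddist (rt c Q' T₀) (oflipCM c hc2 t Ψ) = bpot c T₀ (oflipCM c hc2 t Ψ) → rt c Q' T₀ = rt c Q₁ T₀) ∧
        (∀ Q' : G, ddist (rt c Q' T₀) (oflipCM c hc2 t' Ψ) = bpot c T₀ (oflipCM c hc2 t' Ψ) → rt c Q' T₀ = rt c Q₁ T₀) ∧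
        (∀ Q' : G, ddist (rt c Q' T₀) (oflipCM c hc2 t (oflipCM c hc2 t' Ψ)) = bpot c T₀ (oflipCM c hc2 t (oflipCM c hc2 t' Ψ)) →
          rt c Q' T₀ = rt c Q₁ T₀)) →
      (∀ Q' : G, ddist (rt c Q' T₀) (oflipCM c hc2 s Ψ) = bpot c T₀ (oflipCM c hc2 s Ψ) → rt c Q' T₀ = rt c Q₂ T₀) ∧
      (∀ Q' : G, ddist (rt c Q' T₀) (oflipCM c hc2 s' Ψ) = bpot c T₀ (oflipCM c hc2 s' Ψ) → rt c Q' T₀ = rt c Q₂ T₀) ∧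
      (∀ Q' : G, ddist (rt c Q' T₀) (oflipCM c hc2 s (oflipCM c hc2 s' Ψ)) = bpot c T₀ (oflipCM c hc2 s (oflipCM c hc2 s' Ψ)) →
        rt c Q' T₀ = rt c Q₂ T₀)))

/-! ## §1 The frame change of an orbit type: `(θ_{T₀} − θ_{T₁})(typeSum [Φ]) = R(T) + Y'(A)` -/

include hc2 hH in
/-- **`(θ_{T₀} − θ_{T₁})(typeSum [Φ]) = R(T) + Σ_{a∈A} Y'_a`** for the type `Φ` with deviation set `T ∪ A`, `T ⊆ 𝓗` of size `m`, `A ⊆ T₀ ∖ 𝓗`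
(an identity in `ℤ[types]`, no pairs). [folklore] -/
theorem thetaG_sub_thetaG_orbit_type (T A : Finset G) (hTH : T ⊆ T₀.1 \ T₁.1) (hTm : T.card = m) (hA : A ⊆ T₀.1 \ (T₀.1 \ T₁.1))
    (Φ : CMF G c) (hΦ : T₀.1 \ Φ.1 = T ∪ A) :
    thetaG c hc2 T₀ (typeSum G c (Finsupp.single Φ 1)) - thetaG c hc2 T₁ (typeSum G c (Finsupp.single Φ 1)) =
      (∑ s ∈ T, Finsupp.single (oflipCM c hc2 s T₀) (1 : ℤ) - ∑ u ∈ (T₀.1 \ T₁.1) \ T, Finsupp.single (oflipCM c hc2 u T₁) (1 : ℤ) -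
        ((m : ℤ) - 1) • (Finsupp.single T₀ (1 : ℤ) - Finsupp.single T₁ 1)) +
      ∑ a ∈ A, ((Finsupp.single (oflipCM c hc2 a T₀) (1 : ℤ) - Finsupp.single T₀ 1) -
        (Finsupp.single (oflipCM c hc2 a T₁) (1 : ℤ) - Finsupp.single T₁ 1)) := by
  have hAdisj : Disjoint A (T₀.1 \ T₁.1) := by
    rw [disjoint_iff_ne]; rintro x hx y hy rfl; exact (mem_sdiff.mp (hA hx)).2 hy
  have hTA : Disjoint T A := by
    rw [disjoint_iff_ne]; rintro x hx y hy rfl; exact (mem_sdiff.mp (hA hy)).2 (hTH hx)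
  have h1 : (T ∪ A) \ (T₀.1 \ T₁.1) = A := by
    ext x; simp only [mem_sdiff, mem_union]
    constructor
    · rintro ⟨h | h, h'⟩
      · exact absurd (mem_sdiff.mp (hTH h)) h'
      · exact h
    · intro h; exact ⟨Or.inr h, fun h'' => (disjoint_left.mp hAdisj h) (mem_sdiff.mpr h'')⟩
  have h2 : (T₀.1 \ T₁.1) \ (T ∪ A) = (T₀.1 \ T₁.1) \ T := by
    ext x; simp only [mem_sdiff, mem_union, not_or]
    constructor
    · rintro ⟨h, h', -⟩; exact ⟨h, h'⟩
    · rintro ⟨h, h'⟩; exact ⟨h, h', fun ha => (disjoint_right.mp hAdisj (mem_sdiff.mpr h)) ha⟩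
  rw [thetaG_typeSum_single c T₀ hc2 Φ, thetaG_frame c hc2 T₀ T₁ Φ, hΦ, h1, h2, sum_union hTA]
  have hcardD : ((T₀.1 \ T₁.1) \ T).card = m := by rw [card_sdiff_of_subset hTH, hH, hTm]; omega
  simp only [sum_sub_distrib, sum_const, hcardD, hTm, ← Nat.cast_smul_eq_nsmul ℤ]
  module

/-! ## §2 The designated orbit face: `(θ_{T₀} − θ_{T₁})(typeSum [Φ]) − Y'_{a₀} − Y'_x ∈ L` for a `σ`-neighbour `x` of `a₀` -/

include hH hQ hQ₁ hσH hLrt in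
/-- **THE DESIGNATED ORBIT FACE RELATION, DIRECTIONAL FORM.**  Base-involutive frame, `T ⊆ 𝓗` a transversal of the swap (`|T| = m`), `A ⊆ T₀ ∖ 𝓗`
stable under the swap, `Φ = {T ∣ A}`; `a₃, a₀, a₁ ∈ A` with `σa₃ = a₀`, `σa₀ = a₁` (as place representatives), `a₀ ≠ a₁`, `a₃ ≠ a₀`; the face of `Φ`
at the places `a₀, a₁` lies in the base-change stable lattice `L`, and the corners `Φ^{(a₀a₁)}`, `Φ^{(a₀)}` have star normal forms toward base types
`B₁, B₂ ∈ {T₀, T₁}` modulo `L`.  Then `(θ_{T₀} − θ_{T₁})(typeSum [Φ]) − Y'_{a₀} − Y'_{a₁} ∈ L` if `B₁ = B₂`, and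
`(θ_{T₀} − θ_{T₁})(typeSum [Φ]) − Y'_{a₀} − Y'_{a₃} ∈ L` if `B₁ ≠ B₂` (`Y'_s = (f_s − e₀) − (g_s − e₁)`). [folklore] -/
theorem orbit_face_relation_of_dirs (T A : Finset G) (hTH : T ⊆ T₀.1 \ T₁.1)
    (hT : ∀ t ∈ T₀.1 \ T₁.1, ∀ t' ∈ T₀.1, (t' = t * Q ∨ t' = c * (t * Q)) → (t ∈ T ↔ t' ∉ T))
    (hA : A ⊆ T₀.1 \ (T₀.1 \ T₁.1))
    (hAσ : ∀ t ∈ T₀.1 \ (T₀.1 \ T₁.1), ∀ t' ∈ T₀.1, (t' = t * Q ∨ t' = c * (t * Q)) → (t ∈ A ↔ t' ∈ A))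
    (Φ : CMF G c) (hΦ : T₀.1 \ Φ.1 = T ∪ A) {a₃ a₀ a₁ : G} (ha₃ : a₃ ∈ A) (ha₀ : a₀ ∈ A) (ha₁ : a₁ ∈ A)
    (h₃₀ : a₀ = a₃ * Q ∨ a₀ = c * (a₃ * Q)) (h₀₁ : a₁ = a₀ * Q ∨ a₁ = c * (a₀ * Q)) (hne₀₁ : a₀ ≠ a₁) (hne₃₀ : a₃ ≠ a₀)
    (hF : gface c hc2 Φ a₀ a₁ ∈ L) {B₁ B₂ : CMF G c} (hB₁ : B₁ = T₀ ∨ B₁ = T₁) (hB₂ : B₂ = T₀ ∨ B₂ = T₁)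
    (h1 : Finsupp.single (oflipCM c hc2 a₀ (oflipCM c hc2 a₁ Φ)) 1 -
      thetaG c hc2 B₁ (typeSum G c (Finsupp.single (oflipCM c hc2 a₀ (oflipCM c hc2 a₁ Φ)) 1)) ∈ L)
    (h2 : Finsupp.single (oflipCM c hc2 a₀ Φ) 1 - thetaG c hc2 B₂ (typeSum G c (Finsupp.single (oflipCM c hc2 a₀ Φ) 1)) ∈ L)
    (hm : 1 ≤ m) :
    (B₁ = B₂ → (thetaG c hc2 T₀ (typeSum G c (Finsupp.single Φ 1)) - thetaG c hc2 T₁ (typeSum G c (Finsupp.single Φ 1))) -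
        ((Finsupp.single (oflipCM c hc2 a₀ T₀) (1 : ℤ) - Finsupp.single T₀ 1) - (Finsupp.single (oflipCM c hc2 a₀ T₁) (1 : ℤ) - Finsupp.single T₁ 1)) -
        ((Finsupp.single (oflipCM c hc2 a₁ T₀) (1 : ℤ) - Finsupp.single T₀ 1) - (Finsupp.single (oflipCM c hc2 a₁ T₁) (1 : ℤ) - Finsupp.single T₁ 1)) ∈ L) ∧
    (B₁ ≠ B₂ → (thetaG c hc2 T₀ (typeSum G c (Finsupp.single Φ 1)) - thetaG c hc2 T₁ (typeSum G c (Finsupp.single Φ 1))) -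
        ((Finsupp.single (oflipCM c hc2 a₀ T₀) (1 : ℤ) - Finsupp.single T₀ 1) - (Finsupp.single (oflipCM c hc2 a₀ T₁) (1 : ℤ) - Finsupp.single T₁ 1)) -
        ((Finsupp.single (oflipCM c hc2 a₃ T₀) (1 : ℤ) - Finsupp.single T₀ 1) - (Finsupp.single (oflipCM c hc2 a₃ T₁) (1 : ℤ) - Finsupp.single T₁ 1)) ∈ L) := by
  have hT₀₁ : T₀ ≠ T₁ := by
    intro h; rw [h, Finset.sdiff_self, Finset.card_empty] at hH; omega
  -- memberships
  have hAT₀ : ∀ x ∈ A, x ∈ T₀.1 := fun x hx => (mem_sdiff.mp (hA hx)).1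
  have hAT₁ : ∀ x ∈ A, x ∈ T₁.1 := fun x hx => by
    obtain ⟨h0, hH'⟩ := mem_sdiff.mp (hA hx)
    by_contra h; exact hH' (mem_sdiff.mpr ⟨h0, h⟩)
  have hAD : ∀ x ∈ A, x ∈ T₀.1 \ Φ.1 := fun x hx => by rw [hΦ]; exact mem_union_right _ hx
  have hAΦ : ∀ x ∈ A, x ∉ Φ.1 := fun x hx => (mem_sdiff.mp (hAD x hx)).2
  have hTA : Disjoint T A := by
    rw [disjoint_iff_ne]; rintro x hx y hy rfl; exact (mem_sdiff.mp (hA hy)).2 (hTH hx)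
  have hnotT : ∀ x ∈ A, x ∉ T := fun x hx h => (disjoint_left.mp hTA h) hx
  -- `Q`-stability of `Φ`; the swap is base-involutive
  have hstab : rt c Q Φ = Φ :=
    rt_eq_self_of_transversal c T₀ Q (T₀.1 \ T₁.1) (by rw [hQ]) hσH Φ T A hΦ hTH hA hT hAσ
  have hstab' : rt c Q⁻¹ Φ = Φ := by conv_lhs => rw [← hstab]
                                     rw [rt_inv_rt]
  have hQ'₀ : rt c Q⁻¹ T₀ = T₁ := by rw [← hQ₁, rt_inv_rt]
  have hQ'₁ : rt c Q⁻¹ T₁ = T₀ := by rw [← hQ, rt_inv_rt]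
  -- the flipped places under the swap
  have hf₁ : ∀ Ψ : CMF G c, oflipCM c hc2 (a₁ * Q⁻¹) Ψ = oflipCM c hc2 a₀ Ψ := by
    intro Ψ; rcases h₀₁ with h | h
    · rw [h, mul_inv_cancel_right]
    · rw [h, mul_assoc, mul_inv_cancel_right, oflipCM_cmul]
  have hf₃ : ∀ Ψ : CMF G c, oflipCM c hc2 (a₀ * Q⁻¹) Ψ = oflipCM c hc2 a₃ Ψ := by
    intro Ψ; rcases h₃₀ with h | h
    · rw [h, mul_inv_cancel_right]
    · rw [h, mul_assoc, mul_inv_cancel_right, oflipCM_cmul]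
  have hg₀ : ∀ Ψ : CMF G c, oflipCM c hc2 (a₀ * Q⁻¹⁻¹) Ψ = oflipCM c hc2 a₁ Ψ := by
    intro Ψ; rw [inv_inv]; rcases h₀₁ with h | h
    · rw [← h]
    · rw [← oflipCM_cmul c hc2 (a₀ * Q), ← h]
  -- the translated corners
  have hX₁' : rt c Q⁻¹ (oflipCM c hc2 a₀ Φ) = oflipCM c hc2 a₁ Φ := by rw [rt_oflipCM, hstab', hg₀]
  have hX₃ : rt c Q (oflipCM c hc2 a₀ Φ) = oflipCM c hc2 a₃ Φ := by rw [rt_oflipCM, hstab, hf₃]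
  have hX₂' : rt c Q (oflipCM c hc2 a₀ (oflipCM c hc2 a₁ Φ)) = oflipCM c hc2 a₃ (oflipCM c hc2 a₀ Φ) := by
    rw [rt_oflipCM, rt_oflipCM, hstab, hf₃, hf₁]
  -- `W = F − F·Q⁻¹ ∈ L`
  have hF' : Finsupp.mapDomain (rt c Q) (gface c hc2 Φ a₀ a₁) ∈ L := hLrt Q _ hF
  rw [mapDomain_rt_gface, hstab] at hF'
  have hW : Finsupp.single (oflipCM c hc2 a₀ (oflipCM c hc2 a₁ Φ)) (1 : ℤ) - Finsupp.single (oflipCM c hc2 a₁ Φ) 1 -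
      Finsupp.single (oflipCM c hc2 a₃ (oflipCM c hc2 a₀ Φ)) 1 + Finsupp.single (oflipCM c hc2 a₃ Φ) 1 ∈ L := by
    have h := Submodule.sub_mem _ hF hF'
    have e : gface c hc2 Φ a₀ a₁ - gface c hc2 Φ (a₀ * Q⁻¹) (a₁ * Q⁻¹) =
        Finsupp.single (oflipCM c hc2 a₀ (oflipCM c hc2 a₁ Φ)) (1 : ℤ) - Finsupp.single (oflipCM c hc2 a₁ Φ) 1 -
          Finsupp.single (oflipCM c hc2 a₃ (oflipCM c hc2 a₀ Φ)) 1 + Finsupp.single (oflipCM c hc2 a₃ Φ) 1 := by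
      unfold gface; simp only [hf₁, hf₃]; abel
    rwa [e] at h
  have ha₀D' : a₀ ∈ T₀.1 \ (oflipCM c hc2 a₁ Φ).1 := by
    rw [dev_oflip c hc2 (hAT₀ a₁ ha₁) (hAΦ a₁ ha₁)]; exact mem_erase.mpr ⟨hne₀₁, hAD a₀ ha₀⟩
  -- transport of star defects along base changes
  have transport : ∀ (R : G) (B X : CMF G c), Finsupp.single X 1 - thetaG c hc2 B (typeSum G c (Finsupp.single X 1)) ∈ L →
      Finsupp.single (rt c R X) 1 - thetaG c hc2 (rt c R B) (typeSum G c (Finsupp.single (rt c R X) 1)) ∈ L := by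
    intro R B X h
    have h' := hLrt R _ h
    rwa [Finsupp.mapDomain_sub, Finsupp.mapDomain_single, mapDomain_rt_thetaG] at h'
  -- star forms of the flipped types: star forms of `Φ` minus flip classes (all flipped places are deviation places of `Φ` for `T₀` and for `T₁`)
  have ha₃D₀ : a₃ ∉ (oflipCM c hc2 a₀ Φ).1 := by
    have h : a₃ ∈ T₀.1 \ (oflipCM c hc2 a₀ Φ).1 := by
      rw [dev_oflip c hc2 (hAT₀ a₀ ha₀) (hAΦ a₀ ha₀)]; exact mem_erase.mpr ⟨hne₃₀, hAD a₃ ha₃⟩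
    exact (mem_sdiff.mp h).2
  have ha₀D₁ : a₀ ∉ (oflipCM c hc2 a₁ Φ).1 := (mem_sdiff.mp ha₀D').2
  have e0_1 := thetaG_typeSum_oflipCM_of_not_mem c hc2 T₀ Φ (hAT₀ a₁ ha₁) (hAΦ a₁ ha₁)
  have e0_3 := thetaG_typeSum_oflipCM_of_not_mem c hc2 T₀ Φ (hAT₀ a₃ ha₃) (hAΦ a₃ ha₃)
  have e0_01 := thetaG_typeSum_oflipCM_of_not_mem c hc2 T₀ (oflipCM c hc2 a₁ Φ) (hAT₀ a₀ ha₀) ha₀D₁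
  have e0_30 := thetaG_typeSum_oflipCM_of_not_mem c hc2 T₀ (oflipCM c hc2 a₀ Φ) (hAT₀ a₃ ha₃) ha₃D₀
  have e0_0 := thetaG_typeSum_oflipCM_of_not_mem c hc2 T₀ Φ (hAT₀ a₀ ha₀) (hAΦ a₀ ha₀)
  have e1_1 := thetaG_typeSum_oflipCM_of_not_mem c hc2 T₁ Φ (hAT₁ a₁ ha₁) (hAΦ a₁ ha₁)
  have e1_3 := thetaG_typeSum_oflipCM_of_not_mem c hc2 T₁ Φ (hAT₁ a₃ ha₃) (hAΦ a₃ ha₃)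
  have e1_01 := thetaG_typeSum_oflipCM_of_not_mem c hc2 T₁ (oflipCM c hc2 a₁ Φ) (hAT₁ a₀ ha₀) ha₀D₁
  have e1_30 := thetaG_typeSum_oflipCM_of_not_mem c hc2 T₁ (oflipCM c hc2 a₀ Φ) (hAT₁ a₃ ha₃) ha₃D₀
  have e1_0 := thetaG_typeSum_oflipCM_of_not_mem c hc2 T₁ Φ (hAT₁ a₀ ha₀) (hAΦ a₀ ha₀)
  -- the four direction cases
  rcases hB₁ with hB₁ | hB₁ <;> rcases hB₂ with hB₂ | hB₂ <;> rw [hB₁] at h1 <;> rw [hB₂] at h2 <;> rw [hB₁, hB₂]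
  · -- `B₁ = T₀`, `B₂ = T₀`
    refine ⟨fun _ => ?_, fun h => absurd rfl h⟩
    have t2 := transport Q T₀ _ h1; rw [hX₂', hQ] at t2
    have t3 := transport Q⁻¹ T₀ _ h2; rw [hX₁', hQ'₀] at t3
    have t4 := transport Q T₀ _ h2; rw [hX₃, hQ] at t4
    have hN := Submodule.sub_mem _ (Submodule.add_mem _ (Submodule.add_mem _ (Submodule.sub_mem _ hW h1) t3) t2) t4
    simp only [e0_01, e0_1, e1_1, e1_3, e1_30, e1_0] at hN
    convert hN using 1; module
  · -- `B₁ = T₀`, `B₂ = T₁`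
    refine ⟨fun h => absurd h hT₀₁, fun _ => ?_⟩
    have t2 := transport Q T₀ _ h1; rw [hX₂', hQ] at t2
    have t3 := transport Q⁻¹ T₁ _ h2; rw [hX₁', hQ'₁] at t3
    have t4 := transport Q T₁ _ h2; rw [hX₃, hQ₁] at t4
    have hN := Submodule.sub_mem _ (Submodule.add_mem _ (Submodule.add_mem _ (Submodule.sub_mem _ hW h1) t3) t2) t4
    simp only [e0_01, e0_1, e0_3, e1_30, e1_0] at hN
    convert hN using 1; module
  · -- `B₁ = T₁`, `B₂ = T₀`
    refine ⟨fun h => absurd h.symm hT₀₁, fun _ => ?_⟩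
    have t2 := transport Q T₁ _ h1; rw [hX₂', hQ₁] at t2
    have t3 := transport Q⁻¹ T₀ _ h2; rw [hX₁', hQ'₀] at t3
    have t4 := transport Q T₀ _ h2; rw [hX₃, hQ] at t4
    have hN := Submodule.sub_mem _ (Submodule.add_mem _ (Submodule.add_mem _ (Submodule.sub_mem _ hW h1) t3) t2) t4
    simp only [e0_30, e0_0, e1_1, e1_3, e1_01] at hN
    have hN' := Submodule.neg_mem _ hN
    convert hN' using 1; module
  · -- `B₁ = T₁`, `B₂ = T₁`
    refine ⟨fun _ => ?_, fun h => absurd rfl h⟩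
    have t2 := transport Q T₁ _ h1; rw [hX₂', hQ₁] at t2
    have t3 := transport Q⁻¹ T₁ _ h2; rw [hX₁', hQ'₁] at t3
    have t4 := transport Q T₁ _ h2; rw [hX₃, hQ₁] at t4
    have hN := Submodule.sub_mem _ (Submodule.add_mem _ (Submodule.add_mem _ (Submodule.sub_mem _ hW h1) t3) t2) t4
    simp only [e0_1, e0_3, e0_30, e0_0, e1_1, e1_01] at hN
    have hN' := Submodule.neg_mem _ hN
    convert hN' using 1; module

include hcen hbase hn hH hQ hQ₁ hσH hLrt hcover in
/-- **THE DESIGNATED ORBIT FACE RELATION** (dichotomy form).  As above with `|T| = m ≥ 2`, `|A| ≤ m` and a strict lowering cover behind `L`: the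
corners are resolved by part XXXIV, so `(θ_{T₀} − θ_{T₁})(typeSum [Φ]) − Y'_{a₀} − Y'_{a₁} ∈ L` OR `(θ_{T₀} − θ_{T₁})(typeSum [Φ]) − Y'_{a₀} − Y'_{a₃} ∈ L`.
[folklore] -/
theorem orbit_face_relation (hm : 2 ≤ m) (T A : Finset G) (hTH : T ⊆ T₀.1 \ T₁.1) (hTm : T.card = m)
    (hT : ∀ t ∈ T₀.1 \ T₁.1, ∀ t' ∈ T₀.1, (t' = t * Q ∨ t' = c * (t * Q)) → (t ∈ T ↔ t' ∉ T))
    (hA : A ⊆ T₀.1 \ (T₀.1 \ T₁.1)) (hAm : A.card ≤ m)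
    (hAσ : ∀ t ∈ T₀.1 \ (T₀.1 \ T₁.1), ∀ t' ∈ T₀.1, (t' = t * Q ∨ t' = c * (t * Q)) → (t ∈ A ↔ t' ∈ A))
    (Φ : CMF G c) (hΦ : T₀.1 \ Φ.1 = T ∪ A) {a₃ a₀ a₁ : G} (ha₃ : a₃ ∈ A) (ha₀ : a₀ ∈ A) (ha₁ : a₁ ∈ A)
    (h₃₀ : a₀ = a₃ * Q ∨ a₀ = c * (a₃ * Q)) (h₀₁ : a₁ = a₀ * Q ∨ a₁ = c * (a₀ * Q)) (hne₀₁ : a₀ ≠ a₁) (hne₃₀ : a₃ ≠ a₀)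
    (hF : gface c hc2 Φ a₀ a₁ ∈ L) :
    (thetaG c hc2 T₀ (typeSum G c (Finsupp.single Φ 1)) - thetaG c hc2 T₁ (typeSum G c (Finsupp.single Φ 1))) -
        ((Finsupp.single (oflipCM c hc2 a₀ T₀) (1 : ℤ) - Finsupp.single T₀ 1) - (Finsupp.single (oflipCM c hc2 a₀ T₁) (1 : ℤ) - Finsupp.single T₁ 1)) -
        ((Finsupp.single (oflipCM c hc2 a₁ T₀) (1 : ℤ) - Finsupp.single T₀ 1) - (Finsupp.single (oflipCM c hc2 a₁ T₁) (1 : ℤ) - Finsupp.single T₁ 1)) ∈ L ∨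
    (thetaG c hc2 T₀ (typeSum G c (Finsupp.single Φ 1)) - thetaG c hc2 T₁ (typeSum G c (Finsupp.single Φ 1))) -
        ((Finsupp.single (oflipCM c hc2 a₀ T₀) (1 : ℤ) - Finsupp.single T₀ 1) - (Finsupp.single (oflipCM c hc2 a₀ T₁) (1 : ℤ) - Finsupp.single T₁ 1)) -
        ((Finsupp.single (oflipCM c hc2 a₃ T₀) (1 : ℤ) - Finsupp.single T₀ 1) - (Finsupp.single (oflipCM c hc2 a₃ T₁) (1 : ℤ) - Finsupp.single T₁ 1)) ∈ L := by
  have hAT₀ : ∀ x ∈ A, x ∈ T₀.1 := fun x hx => (mem_sdiff.mp (hA hx)).1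
  have hAD : ∀ x ∈ A, x ∈ T₀.1 \ Φ.1 := fun x hx => by rw [hΦ]; exact mem_union_right _ hx
  have hAΦ : ∀ x ∈ A, x ∉ Φ.1 := fun x hx => (mem_sdiff.mp (hAD x hx)).2
  have hTA : Disjoint T A := by
    rw [disjoint_iff_ne]; rintro x hx y hy rfl; exact (mem_sdiff.mp (hA hy)).2 (hTH hx)
  have hnotT : ∀ x ∈ A, x ∉ T := fun x hx h => (disjoint_left.mp hTA h) hx
  -- the two dichotomies (part XXXIV) at `Φ^{(a₀)}` and `Φ^{(a₀a₁)}`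
  have ha₀D' : a₀ ∈ T₀.1 \ (oflipCM c hc2 a₁ Φ).1 := by
    rw [dev_oflip c hc2 (hAT₀ a₁ ha₁) (hAΦ a₁ ha₁)]; exact mem_erase.mpr ⟨hne₀₁, hAD a₀ ha₀⟩
  have hD₁ : T₀.1 \ (oflipCM c hc2 a₀ Φ).1 = T ∪ A.erase a₀ := by
    rw [dev_oflip c hc2 (hAT₀ a₀ ha₀) (hAΦ a₀ ha₀), hΦ, erase_union_distrib, erase_eq_of_notMem (hnotT a₀ ha₀)]
  have hD₂ : T₀.1 \ (oflipCM c hc2 a₀ (oflipCM c hc2 a₁ Φ)).1 = T ∪ (A.erase a₁).erase a₀ := by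
    rw [dev_oflip c hc2 (mem_sdiff.mp ha₀D').1 (mem_sdiff.mp ha₀D').2, dev_oflip c hc2 (hAT₀ a₁ ha₁) (hAΦ a₁ ha₁), hΦ,
      erase_union_distrib, erase_eq_of_notMem (hnotT a₁ ha₁), erase_union_distrib, erase_eq_of_notMem (hnotT a₀ ha₀)]
  have h2 := single_sub_thetaG_mem_or_of_orbit_corner c hc2 hcen T₀ T₁ hbase m hn hH Q hQ L hcover hm T (A.erase a₀) hTH hTm
    ((erase_subset _ _).trans hA) (by rw [card_erase_of_mem ha₀]; omega) _ hD₁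
  have h1 := single_sub_thetaG_mem_or_of_orbit_corner c hc2 hcen T₀ T₁ hbase m hn hH Q hQ L hcover hm T ((A.erase a₁).erase a₀) hTH hTm
    ((erase_subset _ _).trans ((erase_subset _ _).trans hA))
    (by rw [card_erase_of_mem (mem_erase.mpr ⟨hne₀₁, ha₀⟩), card_erase_of_mem ha₁]; omega) _ hD₂
  rcases h1 with h1 | h1 <;> rcases h2 with h2 | h2
  · exact Or.inl ((orbit_face_relation_of_dirs c hc2 T₀ T₁ m hH Q hQ hQ₁ hσH L hLrt T A hTH hT hA hAσ Φ hΦ ha₃ ha₀ ha₁ h₃₀ h₀₁ hne₀₁ hne₃₀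
      hF (Or.inl rfl) (Or.inl rfl) h1 h2 (by omega)).1 rfl)
  · exact Or.inr ((orbit_face_relation_of_dirs c hc2 T₀ T₁ m hH Q hQ hQ₁ hσH L hLrt T A hTH hT hA hAσ Φ hΦ ha₃ ha₀ ha₁ h₃₀ h₀₁ hne₀₁ hne₃₀
      hF (Or.inl rfl) (Or.inr rfl) h1 h2 (by omega)).2 (fun h => by
        rw [h, Finset.sdiff_self, Finset.card_empty] at hH; omega))
  · exact Or.inr ((orbit_face_relation_of_dirs c hc2 T₀ T₁ m hH Q hQ hQ₁ hσH L hLrt T A hTH hT hA hAσ Φ hΦ ha₃ ha₀ ha₁ h₃₀ h₀₁ hne₀₁ hne₃₀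
      hF (Or.inr rfl) (Or.inl rfl) h1 h2 (by omega)).2 (fun h => by
        rw [← h, Finset.sdiff_self, Finset.card_empty] at hH; omega))
  · exact Or.inl ((orbit_face_relation_of_dirs c hc2 T₀ T₁ m hH Q hQ hQ₁ hσH L hLrt T A hTH hT hA hAσ Φ hΦ ha₃ ha₀ ha₁ h₃₀ h₀₁ hne₀₁ hne₃₀
      hF (Or.inr rfl) (Or.inr rfl) h1 h2 (by omega)).1 rfl)

end Frame

end

end Summit.HodgeConjecture.CorCM.Census.CentralSquares
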